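import Literature.Geometry.Riemannian.BishopGromovDirectional
import Literature.Geometry.Riemannian.ExpMapGlobalSmooth
import Literature.Geometry.Riemannian.NonTrappingConvexSublevelProofs
import Literature.Geometry.Lorentzian.GeodesicConfinement
import HarnessLib

/-!
# The segment inequality of Cheeger–Colding (Ann. of Math. 144 (1996), Thm. 2.11)

J. Cheeger, T. H. Colding, *Lower bounds on Ricci curvature and the almost rigidity of warped
products*, Ann. of Math. 144 (1996) 189–237, §2, Thm. 2.11: for a Riemannian manifold `Yⁿ` with
`Ric ≥ (n-1)Λ`, open `A₁, A₂` with every minimal geodesic from `A₁` to `A₂` inside `W`,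
`D = sup d(y₁, y₂)`, and `ℱ_f(y₁, y₂) = inf_γ ∫₀^{d(y₁,y₂)} f(γ(s)) ds` over minimal geodesics `γ`
from `y₁` to `y₂`,
  `∫_{A₁ × A₂} ℱ_f ≤ c(n, Λ, D) (Vol A₁ + Vol A₂) ∫_W f`
— the tool by which integral (e.g. `L²` Hessian) estimates are converted into estimates along
most minimal geodesics throughout the Cheeger–Colding theory (almost splitting, volume
convergence, Cheeger–Colding 1997 §1–§2 and Appendix 1, Thm. A.1.5). This file PROVES it on
connected complete Riemannian `d`-manifolds with `Ric ≥ -(d-1) g` (the normalisation of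
Cheeger–Colding 1997, (1.1)), for measurable `A, B, U` and lower semicontinuous
`f : M → [0, ∞]`, with the explicit constant `c = D (2 cosh(D/2))^{d-1}`
(`setLIntegral_prod_segmentIntegral_le`).

## Contents

* §1 `segmentIntegral g hg f a b x y` — the DEFINITION of `ℱ_f` with a window `(a, b) ⊆ (0, 1)`
  (`ℱ_f = ℱ^{(0,1)}`, the halves `ℱ⁻ = ℱ^{(0,1/2)}`, `ℱ⁺ = ℱ^{(1/2,1)}` of (2.16)), as an
  infimum over the minimal geodesics `γ_v(t) = exp_x(tv)`, `γ_v|[0,1]` minimizing, `exp_x v = y`;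
  basic API; reversal of minimal geodesics (`exists_reverse_minimizing`) and the symmetry
  `ℱ^{(a,b)}(x, y) ≤ ℱ^{(1-b,1-a)}(y, x)` (`segmentIntegral_le_segmentIntegral_swap`).
* §2 Tools: the area formula for functions (`setLIntegral_image_eq_setLIntegral_mul_jacobian`,
  from the tree's set version), the two-variable exchange lemma of (2.19)–(2.21)
  (`setLIntegral_mul_setLIntegral_half_le`), `sinh t ≤ 2cosh(D/2) sinh s` for `t/2 ≤ s`,
  `t ≤ D`, and the linear change of variables on a ray.
* §3 `setLIntegral_segmentIntegral_half_le` — the estimate for `∫_B ℱ⁺(x, ·)` about a fixed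
  centre ((2.17)–(2.21)) in exponential polar coordinates (`expPolar_data`) with Bishop–Gromov
  along rays (`indicator_jacobian_mul_sinh_pow_le`, `BishopGromovDirectional.lean`).
* §4 `lowerSemicontinuous_segmentIntegral`, `measurable_segmentIntegral` — `ℱ_f^{(a,b)}` is lower
  semicontinuous on `M × M` for lower semicontinuous `f` (compactness in `TM`, continuity of
  `exp` on `TM`, Fatou), the regularity implicit in the printed `∫_{A₁×A₂} ℱ_f`; on the way,
  first countability of charted spaces and of `TM`.
* §5 `segmentIntegral_le_add_of_mem_injectivityDomain` (`ℱ ≤ ℱ⁻ + ℱ⁺` off the cut locus, by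
  uniqueness of minimal geodesics, `false_of_two_minimizers`) and the theorem.

RELATION TO `HalfSegmentInequality.lean` (seat of `Colding1996_volume_ghClose`, landed the same
day): that file proves the half estimate AT A POINT for `κ = 1` (`Ric ≥ m - 1`, `R ≤ π/2`) in the
tangent space (`∫ 𝒥(v) ∫_{1/2}^1 e(exp(sv)) ≤ 2^{m-1} ∫ 𝒥 e`), without the functional `ℱ` on
`M × M`. Here: `κ = -1`, the functional `ℱ_f` itself, its measurability, the symmetry argument
and the full two-set statement of Thm. 2.11.

One definition (`segmentIntegral`, with body); no named facts (D-0026). Written as groundwork for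
`CheegerColding1997_sphereStability` (Cheeger–Colding 1997, Thm. A.1.12, through Thm. A.1.5).

## References

* J. Cheeger, T. H. Colding, *Lower bounds on Ricci curvature and the almost rigidity of warped
  products*, Ann. of Math. 144 (1996) 189–237, §2, (2.6)–(2.21), Thm. 2.11 (pp. 198–200; read:
  `lit read paper:doi-10-2307-2118589`, PDF pp. 11–13). [CheegerColding1996]
* J. Cheeger, T. H. Colding, *On the structure of spaces with Ricci curvature bounded below. I*,
  J. Differential Geom. 46 (1997) 406–480, §1 and Appendix 1. [CheegerColding1997]
* W. Jiang, *On the limit of Kähler manifolds with Ricci curvature lower bound*,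
  arXiv:1409.4471, Prop. 1 (restatement). D. Kazaras, M. Khuri, D. Lee, arXiv:2111.05202,
  Thm. 2.2 (restatement).
* H. Federer, *Geometric Measure Theory* (1969), §3.2.3, §3.2.46 (area formula). [Federer1969]
* J. M. Lee, *Introduction to Riemannian Manifolds*, 2nd ed. (2018), Prop. 5.19, Cor. 6.21,
  Prop. 10.32, Thm. 10.34. [LeeRiemannianManifolds2018]
-/

noncomputable section

open Bundle Set Function Filter MeasureTheory Manifold
open scoped Manifold ContDiff Topology ENNReal NNReal

namespace Literature.Geometry.Riemannian

open Lorentzian Lorentzian.PseudoRiemannianMetric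

/-! ### §1 The functional `ℱ_f` of Cheeger–Colding: integrals of `f` along minimal geodesics -/

section Definition

variable {E : Type*} [NormedAddCommGroup E] [NormedSpace ℝ E] [FiniteDimensional ℝ E]
  [CompleteSpace E] {M : Type*} [TopologicalSpace M] [ChartedSpace E M] [IsManifold 𝓘(ℝ, E) ∞ M]
  (g : PseudoRiemannianMetric 𝓘(ℝ, E) ∞ E (TangentSpace 𝓘(ℝ, E) : M → Type _)) [g.HasLeviCivita]

/-- **Cheeger–Colding's `ℱ_f(x, y)`, with a window `(a, b) ⊆ (0, 1)`**: the infimum, over the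
minimal geodesics `γ_v : [0, 1] → M`, `γ_v(t) = exp_x(t v)`, from `x` to `y` (`v ∈ T_x M` with
`exp_x v = y` and `γ_v|[0,1]` minimizing, `IsMinimizingUpTo`), of `|v|_g ∫_{(a,b)} f(γ_v(t)) dt`
— i.e. of `∫_{aℓ}^{bℓ} f(γ(s)) ds` for the unit speed parametrisation `γ`, `ℓ = d(x, y)`. For
`(a, b) = (0, 1)` this is `ℱ_f(x, y) = inf_γ ∫₀^{d(x,y)} f(γ(s)) ds` of Cheeger–Colding 1996, §2
(the quantity integrated in the segment inequality, Thm. 2.11); the windows `(0, 1/2)` and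
`(1/2, 1)` are the two halves `ℱ_f = ℱ_f⁻ + ℱ_f⁺` of its proof ((2.16)). Values in `ℝ≥0∞`, `f ≥ 0`
extended-real valued. [cite: CheegerColding1996, §2, (2.11)–(2.16) (pp. 198–199)] -/
def segmentIntegral (hg : g.IsRiemannian) (f : M → ℝ≥0∞) (a b : ℝ) (x y : M) : ℝ≥0∞ :=
  ⨅ v : {v : TangentSpace 𝓘(ℝ, E) x //
      IsMinimizingUpTo g hg x v 1 ∧ expMap g.leviCivita x v = y},
    ENNReal.ofReal (Real.sqrt (g.val x v.1 v.1)) *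
      ∫⁻ t in Ioo a b, f (expMap g.leviCivita x (t • v.1))

variable {g}

omit [CompleteSpace E] in
/-- `ℱ_f^{(a,b)}(x, y)` is at most the window integral along any minimal geodesic `γ_v` from `x`
to `y`. [folklore] -/
theorem segmentIntegral_le (hg : g.IsRiemannian) (f : M → ℝ≥0∞) (a b : ℝ) {x y : M}
    {v : TangentSpace 𝓘(ℝ, E) x} (hv : IsMinimizingUpTo g hg x v 1)
    (hvy : expMap g.leviCivita x v = y) :
    segmentIntegral g hg f a b x y ≤
      ENNReal.ofReal (Real.sqrt (g.val x v v)) *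
        ∫⁻ t in Ioo a b, f (expMap g.leviCivita x (t • v)) :=
  iInf_le (fun w' : {v : TangentSpace 𝓘(ℝ, E) x //
      IsMinimizingUpTo g hg x v 1 ∧ expMap g.leviCivita x v = y} ↦
    ENNReal.ofReal (Real.sqrt (g.val x w'.1 w'.1)) *
      ∫⁻ s in Ioo a b, f (expMap g.leviCivita x (s • w'.1))) ⟨v, hv, hvy⟩

omit [CompleteSpace E] in
/-- A lower bound valid along every minimal geodesic from `x` to `y` bounds `ℱ_f^{(a,b)}(x, y)`
from below. [folklore] -/
theorem le_segmentIntegral (hg : g.IsRiemannian) {f : M → ℝ≥0∞} {a b : ℝ} {x y : M} {c : ℝ≥0∞}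
    (h : ∀ v : TangentSpace 𝓘(ℝ, E) x, IsMinimizingUpTo g hg x v 1 → expMap g.leviCivita x v = y →
      c ≤ ENNReal.ofReal (Real.sqrt (g.val x v v)) *
        ∫⁻ t in Ioo a b, f (expMap g.leviCivita x (t • v))) :
    c ≤ segmentIntegral g hg f a b x y :=
  le_iInf fun w ↦ h w.1 w.2.1 w.2.2

omit [CompleteSpace E] in
/-- If `ℱ_f^{(a,b)}(x, y) < c` then some minimal geodesic from `x` to `y` has window integral
`< c`. [folklore] -/
theorem exists_lt_of_segmentIntegral_lt (hg : g.IsRiemannian) {f : M → ℝ≥0∞} {a b : ℝ} {x y : M}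
    {c : ℝ≥0∞} (h : segmentIntegral g hg f a b x y < c) :
    ∃ v : TangentSpace 𝓘(ℝ, E) x, IsMinimizingUpTo g hg x v 1 ∧ expMap g.leviCivita x v = y ∧
      ENNReal.ofReal (Real.sqrt (g.val x v v)) *
        ∫⁻ t in Ioo a b, f (expMap g.leviCivita x (t • v)) < c := by
  obtain ⟨w, hw⟩ := iInf_lt_iff.1 h
  exact ⟨w.1, w.2.1, w.2.2, hw⟩

omit [CompleteSpace E] in
/-- Monotonicity of `ℱ_f^{(a,b)}` in `f`. [folklore] -/
theorem segmentIntegral_mono (hg : g.IsRiemannian) {f f' : M → ℝ≥0∞} (hff' : f ≤ f') (a b : ℝ)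
    (x y : M) : segmentIntegral g hg f a b x y ≤ segmentIntegral g hg f' a b x y :=
  iInf_mono fun _ ↦ mul_le_mul' le_rfl (lintegral_mono fun _ ↦ hff' _)

variable [T2Space M] [CovariantDerivative.ContMDiffCovariantDerivative g.leviCivita 1]

/-- **Minimality on `[0, 1]` on a complete manifold**: `γ_v|[0,1]` is minimizing iff
`|v|_g = d(x, exp_x v)` (`L(γ_v|[0,1]) = |v|_g`, `length_maximalGeodesic`). [folklore] -/
theorem isMinimizingUpTo_one_iff (hg : g.IsRiemannian) (hc : IsGeodesicallyComplete g.leviCivita)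
    (x : M) (v : TangentSpace 𝓘(ℝ, E) x) :
    IsMinimizingUpTo g hg x v 1 ↔
      ENNReal.ofReal (Real.sqrt (g.val x v v)) = g.edist hg x (expMap g.leviCivita x v) := by
  haveI : Fact ((1 : ℕ∞ω) ≤ (∞ : ℕ∞ω)) := ⟨by exact_mod_cast le_top⟩
  obtain ⟨hdom, -, -, -⟩ := maximalGeodesic_of_isGeodesicallyComplete hc x v
  unfold IsMinimizingUpTo
  rw [hdom, length_maximalGeodesic hg hc x v 0 1, sub_zero, one_mul,
    ← expMap_eq_maximalGeodesic hc x v]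
  exact ⟨fun h ↦ h.2, fun h ↦ ⟨subset_univ _, h⟩⟩

/-- **Reversing a minimal geodesic.** If `γ_w`, `w ∈ T_y M`, is a minimal geodesic from `y` to
`x = exp_y w` on `[0, 1]`, then `v = -γ_w'(1) ∈ T_x M` spans the reversed geodesic:
`exp_x(t v) = exp_y((1 - t) w)` for all `t`, `|v|_g = |w|_g`, and `γ_v|[0,1]` is a minimal geodesic
from `x` to `y`. [folklore] -/
theorem exists_reverse_minimizing (hg : g.IsRiemannian) (hc : IsGeodesicallyComplete g.leviCivita)
    {x y : M} {w : TangentSpace 𝓘(ℝ, E) y} (hw : IsMinimizingUpTo g hg y w 1)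
    (hwx : expMap g.leviCivita y w = x) :
    ∃ v : TangentSpace 𝓘(ℝ, E) x, IsMinimizingUpTo g hg x v 1 ∧ expMap g.leviCivita x v = y ∧
      g.val x v v = g.val y w w ∧
      ∀ t : ℝ, expMap g.leviCivita x (t • v) = expMap g.leviCivita y ((1 - t) • w) := by
  haveI : Fact ((1 : ℕ∞ω) ≤ (∞ : ℕ∞ω)) := ⟨by exact_mod_cast le_top⟩
  subst hwx
  -- the geodesic `γ_w` and its reversal
  set γ : ℝ → M := maximalGeodesic g.leviCivita y w with hγ_def
  obtain ⟨-, hgeo, hγ0, hγv⟩ := maximalGeodesic_of_isGeodesicallyComplete hc y w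
  have hγ1 : γ 1 = expMap g.leviCivita y w := (expMap_eq_maximalGeodesic hc y w).symm
  set ρ : ℝ → M := fun t ↦ γ (-1 * t + 1) with hρ_def
  have hρgeo : IsGeodesic g.leviCivita ρ := hgeo.comp_affine (-1) 1
  have hρ0 : ρ 0 = expMap g.leviCivita y w := by
    show γ (-1 * 0 + 1) = _
    rw [mul_zero, zero_add, hγ1]
  -- the reversed initial velocity, read in `T_x M = E`
  set v : TangentSpace 𝓘(ℝ, E) (expMap g.leviCivita y w) :=
    (show TangentSpace 𝓘(ℝ, E) (expMap g.leviCivita y w) from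
      ((velocity 𝓘(ℝ, E) ρ 0 : TangentSpace 𝓘(ℝ, E) (ρ 0)) : E)) with hv_def
  have hlift : tangentLift 𝓘(ℝ, E) ρ 0 =
      (⟨expMap g.leviCivita y w, v⟩ : TangentBundle 𝓘(ℝ, E) M) := by
    refine TotalSpace.ext hρ0 ?_
    exact HEq.rfl
  have hρeq : ρ = maximalGeodesic g.leviCivita (expMap g.leviCivita y w) v :=
    hρgeo.eq_maximalGeodesic hlift
  have hexp : ∀ t : ℝ, expMap g.leviCivita (expMap g.leviCivita y w) (t • v) =
      expMap g.leviCivita y ((1 - t) • w) := by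
    intro t
    rw [expMap_smul hc _ v t, ← congrFun hρeq t, expMap_smul hc y w (1 - t)]
    show γ (-1 * t + 1) = γ (1 - t)
    ring_nf
  -- `|v| = |w|`: the speed of a geodesic is constant
  have hvel : velocity 𝓘(ℝ, E) ρ 0 = (-1 : ℝ) • velocity 𝓘(ℝ, E) γ (-1 * 0 + 1) :=
    velocity_comp_affine γ (-1) 1 0
  have hconst : ∀ s : ℝ, g.val (γ s) (velocity 𝓘(ℝ, E) γ s) (velocity 𝓘(ℝ, E) γ s) =
      g.val y w w := fun s ↦ by
    have h2 := g.val_velocity_eq_of_isGeodesicOn_holds isOpen_univ ordConnected_univ hgeo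
      (mem_univ s) (mem_univ 0)
    rwa [hγv, hγ0] at h2
  have h1 : g.val (ρ 0) (velocity 𝓘(ℝ, E) ρ 0) (velocity 𝓘(ℝ, E) ρ 0) = g.val y w w := by
    have h3 : g.val (ρ 0) (velocity 𝓘(ℝ, E) γ (-1 * 0 + 1)) (velocity 𝓘(ℝ, E) γ (-1 * 0 + 1)) =
        g.val y w w := hconst (-1 * 0 + 1)
    rw [hvel]
    simp only [map_smul, FunLike.coe_smul, Pi.smul_apply, smul_eq_mul]
    rw [h3]
    ring
  have hnorm : g.val (expMap g.leviCivita y w) v v = g.val y w w := by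
    rw [← h1, hρ0]
  refine ⟨v, ?_, ?_, hnorm, hexp⟩
  · -- minimality: `|v| = |w| = d(y, x) = d(x, y)`
    rw [isMinimizingUpTo_one_iff hg hc] at hw ⊢
    have h1 : expMap g.leviCivita (expMap g.leviCivita y w) v = y := by
      have h := hexp 1
      rw [one_smul, sub_self, zero_smul, expMap_zero (cov := g.leviCivita)] at h
      exact h
    rw [h1, hnorm, hw, g.edist_comm hg]
  · have h := hexp 1
    rw [one_smul, sub_self, zero_smul, expMap_zero (cov := g.leviCivita)] at h
    exact h

/-- **Symmetry of `ℱ_f` under reversal of the window**: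
`ℱ_f^{(a,b)}(x, y) ≤ ℱ_f^{(1-b,1-a)}(y, x)` (hence equality): a minimal geodesic from `y` to `x`
reversed is one from `x` to `y`, and `∫_{(a,b)} f(γ_v(t)) dt = ∫_{(1-b,1-a)} f(γ_w(t)) dt`
(`t ↦ 1 - t` preserves Lebesgue measure). In particular `ℱ_f⁻(x, y) ≤ ℱ_f⁺(y, x)`
((2.16)–(2.17): "by an obvious symmetry argument, it suffices to bound `ℱ⁺`").
[cite: CheegerColding1996, §2, (2.16)–(2.17)] -/
theorem segmentIntegral_le_segmentIntegral_swap (hg : g.IsRiemannian)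
    (hc : IsGeodesicallyComplete g.leviCivita) (f : M → ℝ≥0∞) (a b : ℝ) (x y : M) :
    segmentIntegral g hg f a b x y ≤ segmentIntegral g hg f (1 - b) (1 - a) y x := by
  refine le_segmentIntegral hg fun w hw hwx ↦ ?_
  obtain ⟨v, hv, hvy, hnorm, hexp⟩ := exists_reverse_minimizing hg hc hw hwx
  refine (segmentIntegral_le hg f a b hv hvy).trans (le_of_eq ?_)
  rw [hnorm]
  congr 1
  simp_rw [hexp]
  -- `∫_{(a,b)} F(1 - t) dt = ∫_{(1-b,1-a)} F(t) dt`
  have hmp : MeasurePreserving (fun t : ℝ ↦ 1 - t) volume volume :=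
    (volume : Measure ℝ).measurePreserving_sub_left (1 : ℝ)
  have hme : MeasurableEmbedding (fun t : ℝ ↦ 1 - t) :=
    (Homeomorph.subLeft (1 : ℝ)).measurableEmbedding
  have h := hmp.setLIntegral_comp_preimage_emb hme
    (fun t ↦ f (expMap g.leviCivita y (t • w))) (Ioo (1 - b) (1 - a))
  rw [Set.preimage_const_sub_Ioo] at h
  have e1 : (1 : ℝ) - (1 - a) = a := by ring
  have e2 : (1 : ℝ) - (1 - b) = b := by ring
  rw [e1, e2] at h
  exact h

end Definition

/-! ### §2 Tools: the area formula for functions, a two-variable exchange lemma, `sinh` bounds -/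

section AreaFormulaFun

variable {H : Type*} [TopologicalSpace H] {n : ℕ∞ω} {m : ℕ}
  {I : ModelWithCorners ℝ (EuclideanSpace ℝ (Fin m)) H} [I.Boundaryless]
  {N : Type*} [TopologicalSpace N] [ChartedSpace H N] [IsManifold I 1 N]
  [T3Space N] [MeasurableSpace N] [BorelSpace N]

/-- **The area formula for functions**: for `Φ : ℝᵐ → N` differentiable on an open set `W`,
injective on `W` and measurable, a measurable `A ⊆ W` and a measurable `F : N → [0, ∞]`,
`∫_{Φ(A)} F dVol_h = ∫_A F(Φ z) 𝒥(z) dz`, `𝒥 = √(det h(dΦ eᵢ, dΦ eⱼ))` — from the set version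
`riemannianMeasure_image_eq_lintegral_of_injOn` (the two measures `Vol_h⌊Φ(A)` and
`Φ_*(𝒥 · Leb⌊A)` agree on measurable sets). [cite: Federer1969, §3.2.3 and §3.2.46] -/
theorem setLIntegral_image_eq_setLIntegral_mul_jacobian
    (h : ContMDiffRiemannianMetric I n (EuclideanSpace ℝ (Fin m)) (TangentSpace I : N → Type _))
    {W : Set (EuclideanSpace ℝ (Fin m))} (hW : IsOpen W) {Φ : (EuclideanSpace ℝ (Fin m)) → N}
    (hΦ : ContMDiff 𝓘(ℝ, (EuclideanSpace ℝ (Fin m))) I 1 Φ) (hinj : InjOn Φ W)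
    {A : Set (EuclideanSpace ℝ (Fin m))} (hA : MeasurableSet A) (hAW : A ⊆ W)
    {F : N → ℝ≥0∞} (hF : Measurable F) :
    ∫⁻ y in Φ '' A, F y ∂(riemannianMeasure (I := I) h) =
      ∫⁻ z in A, F (Φ z) * ENNReal.ofReal (Real.sqrt (Matrix.of fun i j : Fin m ↦ h.inner (Φ z)
        (mfderiv 𝓘(ℝ, (EuclideanSpace ℝ (Fin m))) I Φ z (EuclideanSpace.single i 1))
        (mfderiv 𝓘(ℝ, (EuclideanSpace ℝ (Fin m))) I Φ z (EuclideanSpace.single j 1))).det) := by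
  classical
  have hd : ∀ z ∈ W, MDifferentiableAt 𝓘(ℝ, (EuclideanSpace ℝ (Fin m))) I Φ z := fun z _ ↦
    (hΦ z).mdifferentiableAt one_ne_zero
  have hΦm : Measurable Φ := hΦ.continuous.measurable
  set Jac : (EuclideanSpace ℝ (Fin m)) → ℝ≥0∞ := fun z ↦ ENNReal.ofReal (Real.sqrt
    (Matrix.of fun i j : Fin m ↦ h.inner (Φ z)
      (mfderiv 𝓘(ℝ, (EuclideanSpace ℝ (Fin m))) I Φ z (EuclideanSpace.single i 1))
      (mfderiv 𝓘(ℝ, (EuclideanSpace ℝ (Fin m))) I Φ z (EuclideanSpace.single j 1))).det)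
    with hJac_def
  have hJac : Measurable Jac :=
    ENNReal.measurable_ofReal.comp (continuous_sqrt_det_inner_mfderiv h hΦ).measurable
  -- the two measures `Vol_h⌊Φ(A)` and `Φ_*(Jac · Leb⌊A)` agree on measurable sets
  set μ : Measure N := riemannianMeasure (I := I) h with hμ
  set ν : Measure N := Measure.map Φ ((volume.restrict A).withDensity Jac) with hν
  have hνS : ∀ S : Set N, MeasurableSet S → ν S = μ (S ∩ Φ '' A) := by
    intro S hS
    rw [hν, Measure.map_apply hΦm hS, withDensity_apply _ (hΦm hS),
      Measure.restrict_restrict (hΦm hS)]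
    have hAS : MeasurableSet (Φ ⁻¹' S ∩ A) := (hΦm hS).inter hA
    rw [← riemannianMeasure_image_eq_lintegral_of_injOn h hW hd hinj hAS
      (inter_subset_right.trans hAW), ← hμ]
    congr 1
    rw [inter_comm, Set.image_inter_preimage, inter_comm]
  have hμν : μ.restrict (Φ '' A) = ν := by
    refine Measure.ext fun S hS ↦ ?_
    rw [Measure.restrict_apply hS, hνS S hS]
  rw [hμν, hν, lintegral_map hF hΦm]
  have hw := lintegral_withDensity_eq_lintegral_mul (volume.restrict A) hJac (hF.comp hΦm)
  have hw' : ∫⁻ a, F (Φ a) ∂(volume.restrict A).withDensity Jac = ∫⁻ z in A, Jac z * F (Φ z) := by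
    rw [show (fun a ↦ F (Φ a)) = F ∘ Φ from rfl, hw]
    rfl
  rw [hw']
  refine lintegral_congr fun z ↦ ?_
  rw [mul_comm]

end AreaFormulaFun

section OneDim

/-- **The two-variable exchange lemma of the proof of Thm. 2.11** ((2.19)–(2.21)): if
`J, F : ℝ → [0, ∞]` are measurable and `J(t) ≤ C · J(s)` whenever `0 < t/2 < s < t ≤ D`, then
`∫_{t ∈ (0,D]} J(t) (∫_{s ∈ (t/2,t)} F(s) ds) dt ≤ C · D · ∫_{s ∈ (0,D)} J(s) F(s) ds`
(Tonelli, and the `t`-integral of `𝟙{s < t < 2s}` is at most `D`).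
[cite: CheegerColding1996, §2, proof of Thm. 2.11, (2.19)–(2.21)] -/
theorem setLIntegral_mul_setLIntegral_half_le {J F : ℝ → ℝ≥0∞} (hJ : Measurable J)
    (hF : Measurable F) {C : ℝ≥0∞} {D : ℝ}
    (h : ∀ s t : ℝ, 0 < t → t / 2 < s → s < t → t ≤ D → J t ≤ C * J s) :
    ∫⁻ t in Ioc 0 D, J t * ∫⁻ s in Ioo (t / 2) t, F s ≤
      C * ENNReal.ofReal D * ∫⁻ s in Ioo 0 D, J s * F s := by
  -- as a double integral of `K(t, s) = 𝟙{0 < t ≤ D} 𝟙{t/2 < s < t} J t F s`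
  have hmeasT : MeasurableSet {q : ℝ × ℝ | q.1 / 2 < q.2 ∧ q.2 < q.1} :=
    (measurableSet_lt (measurable_fst.div_const 2) measurable_snd).inter
      (measurableSet_lt measurable_snd measurable_fst)
  calc ∫⁻ t in Ioc 0 D, J t * ∫⁻ s in Ioo (t / 2) t, F s
      = ∫⁻ t in Ioc 0 D, ∫⁻ s, (Ioo (t / 2) t).indicator (fun s ↦ J t * F s) s := by
        refine setLIntegral_congr_fun measurableSet_Ioc fun t _ ↦ ?_
        rw [← lintegral_indicator measurableSet_Ioo, ← lintegral_const_mul _ (hF.indicator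
          measurableSet_Ioo)]
        refine lintegral_congr fun s ↦ ?_
        by_cases hs : s ∈ Ioo (t / 2) t
        · rw [indicator_of_mem hs, indicator_of_mem hs]
        · rw [indicator_of_notMem hs, indicator_of_notMem hs, mul_zero]
    _ ≤ ∫⁻ t in Ioc 0 D, ∫⁻ s, (Ioo (t / 2) t).indicator (fun s ↦ C * (J s * F s)) s := by
        refine lintegral_mono_ae (ae_restrict_of_forall_mem measurableSet_Ioc fun t ht ↦ ?_)
        refine lintegral_mono fun s ↦ ?_
        by_cases hs : s ∈ Ioo (t / 2) t
        · rw [indicator_of_mem hs, indicator_of_mem hs, ← mul_assoc]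
          exact mul_le_mul' (h s t ht.1 hs.1 hs.2 ht.2) le_rfl
        · rw [indicator_of_notMem hs, indicator_of_notMem hs]
    _ = ∫⁻ t in Ioc 0 D, ∫⁻ s, {q : ℝ × ℝ | q.1 / 2 < q.2 ∧ q.2 < q.1}.indicator
          (fun q ↦ C * (J q.2 * F q.2)) (t, s) := by
        refine setLIntegral_congr_fun measurableSet_Ioc fun t _ ↦ lintegral_congr fun s ↦ ?_
        by_cases hs : s ∈ Ioo (t / 2) t
        · rw [indicator_of_mem hs, indicator_of_mem (show (t, s) ∈ {q : ℝ × ℝ | q.1 / 2 < q.2 ∧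
            q.2 < q.1} from hs)]
        · rw [indicator_of_notMem hs, indicator_of_notMem (show (t, s) ∉ {q : ℝ × ℝ |
            q.1 / 2 < q.2 ∧ q.2 < q.1} from hs)]
    _ = ∫⁻ s, ∫⁻ t in Ioc 0 D, {q : ℝ × ℝ | q.1 / 2 < q.2 ∧ q.2 < q.1}.indicator
          (fun q ↦ C * (J q.2 * F q.2)) (t, s) := by
        rw [lintegral_lintegral_swap]
        exact ((measurable_const.mul ((hJ.comp measurable_snd).mul (hF.comp measurable_snd))).indicator
          hmeasT).aemeasurable
    _ = ∫⁻ s, ∫⁻ t, (Ioc 0 D).indicator (fun t ↦ {q : ℝ × ℝ | q.1 / 2 < q.2 ∧ q.2 < q.1}.indicator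
          (fun q ↦ C * (J q.2 * F q.2)) (t, s)) t := by
        refine lintegral_congr fun s ↦ ?_
        rw [lintegral_indicator measurableSet_Ioc]
    _ ≤ ∫⁻ s, (Ioo 0 D).indicator (fun s ↦ C * (J s * F s) * ENNReal.ofReal D) s := by
        refine lintegral_mono fun s ↦ ?_
        by_cases hs : s ∈ Ioo 0 D
        · rw [indicator_of_mem hs]
          calc ∫⁻ t, (Ioc 0 D).indicator (fun t ↦ {q : ℝ × ℝ | q.1 / 2 < q.2 ∧ q.2 < q.1}.indicator
                (fun q ↦ C * (J q.2 * F q.2)) (t, s)) t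
              ≤ ∫⁻ t, (Ioc s D).indicator (fun _ ↦ C * (J s * F s)) t := by
                refine lintegral_mono fun t ↦ ?_
                by_cases ht : t ∈ Ioc 0 D
                · rw [indicator_of_mem ht]
                  by_cases hts : (t, s) ∈ {q : ℝ × ℝ | q.1 / 2 < q.2 ∧ q.2 < q.1}
                  · rw [indicator_of_mem hts, indicator_of_mem (show t ∈ Ioc s D from
                      ⟨hts.2, ht.2⟩)]
                  · rw [indicator_of_notMem hts]
                    exact zero_le
                · rw [indicator_of_notMem ht]
                  exact zero_le
            _ = C * (J s * F s) * volume (Ioc s D) := by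
                rw [lintegral_indicator measurableSet_Ioc, setLIntegral_const]
            _ ≤ C * (J s * F s) * ENNReal.ofReal D := by
                rw [Real.volume_Ioc]
                exact mul_le_mul' le_rfl (ENNReal.ofReal_le_ofReal (by linarith [hs.1]))
        · rw [indicator_of_notMem hs]
          have hzero : (fun t ↦ (Ioc 0 D).indicator (fun t ↦ {q : ℝ × ℝ | q.1 / 2 < q.2 ∧
              q.2 < q.1}.indicator (fun q ↦ C * (J q.2 * F q.2)) (t, s)) t) = fun _ ↦ 0 := by
            funext t
            by_cases ht : t ∈ Ioc 0 D
            · rw [indicator_of_mem ht]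
              have hts : (t, s) ∉ {q : ℝ × ℝ | q.1 / 2 < q.2 ∧ q.2 < q.1} := by
                intro hts
                have h1 : t / 2 < s := hts.1
                have h2 : s < t := hts.2
                exact hs ⟨by linarith [ht.1], h2.trans_le ht.2⟩
              rw [indicator_of_notMem hts]
            · rw [indicator_of_notMem ht]
          rw [hzero, lintegral_zero]
    _ = ∫⁻ s in Ioo 0 D, C * ENNReal.ofReal D * (J s * F s) := by
        rw [lintegral_indicator measurableSet_Ioo]
        refine setLIntegral_congr_fun measurableSet_Ioo fun s _ ↦ ?_
        ring
    _ = C * ENNReal.ofReal D * ∫⁻ s in Ioo 0 D, J s * F s :=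
        lintegral_const_mul (C * ENNReal.ofReal D) (hJ.mul hF)

end OneDim


section OneDimTwo

/-- **`sinh t ≤ 2 cosh(D/2) sinh s` for `0 < t ≤ D`, `t/2 ≤ s`** (`sinh t = 2 sinh(t/2) cosh(t/2)`,
monotonicity of `sinh` and of `cosh` on `[0, ∞)`). [folklore] -/
theorem sinh_le_two_mul_cosh_mul_sinh {s t D : ℝ} (ht : 0 < t) (hts : t / 2 ≤ s) (htD : t ≤ D) :
    Real.sinh t ≤ 2 * Real.cosh (D / 2) * Real.sinh s := by
  have h1 : Real.sinh t = 2 * Real.sinh (t / 2) * Real.cosh (t / 2) := by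
    rw [← Real.sinh_two_mul]; ring_nf
  have h2 : Real.sinh (t / 2) ≤ Real.sinh s := Real.sinh_le_sinh.2 hts
  have h3 : Real.cosh (t / 2) ≤ Real.cosh (D / 2) := by
    rw [Real.cosh_le_cosh, abs_of_pos (by linarith), abs_of_pos (by linarith)]
    linarith
  have h4 : 0 ≤ Real.sinh (t / 2) := Real.sinh_nonneg_iff.2 (by linarith)
  have h5 : 0 ≤ Real.cosh (D / 2) := (Real.cosh_pos _).le
  rw [h1]
  nlinarith [mul_le_mul h2 h3 ((Real.cosh_pos _).le) (h4.trans h2)]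

/-- The power form: `sinh^k t ≤ (2 cosh(D/2))^k sinh^k s` for `0 < t ≤ D`, `t/2 ≤ s`.
[folklore] -/
theorem sinh_pow_le_mul_sinh_pow {s t D : ℝ} (ht : 0 < t) (hts : t / 2 ≤ s) (htD : t ≤ D)
    (k : ℕ) : Real.sinh t ^ k ≤ (2 * Real.cosh (D / 2)) ^ k * Real.sinh s ^ k := by
  rw [← mul_pow]
  exact pow_le_pow_left₀ (Real.sinh_nonneg_iff.2 ht.le) (sinh_le_two_mul_cosh_mul_sinh ht hts htD) k

/-- **Linear change of variables on a ray**: for `t > 0` and measurable `G : ℝ → [0, ∞]`,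
`∫_{(t/2, t)} G = t ∫_{(1/2, 1)} G(t u) du`. [folklore] -/
theorem setLIntegral_Ioo_half_eq {G : ℝ → ℝ≥0∞} (hG : Measurable G) {t : ℝ} (ht : 0 < t) :
    ∫⁻ s in Ioo (t / 2) t, G s = ENNReal.ofReal t * ∫⁻ u in Ioo (1 / 2 : ℝ) 1, G (t * u) := by
  have hmeas : Measurable fun s : ℝ ↦ t * s := measurable_const_mul t
  calc ∫⁻ s in Ioo (t / 2) t, G s = ∫⁻ s, (Ioo (t / 2) t).indicator G s :=
        (lintegral_indicator measurableSet_Ioo _).symm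
    _ = ∫⁻ s, (Ioo (t / 2) t).indicator G s
          ∂(ENNReal.ofReal |t| • Measure.map (fun s : ℝ ↦ t * s) volume) := by
        rw [Real.smul_map_volume_mul_left ht.ne']
    _ = ENNReal.ofReal t * ∫⁻ u, (Ioo (t / 2) t).indicator G (t * u) := by
        rw [lintegral_smul_measure, lintegral_map (hG.indicator measurableSet_Ioo) hmeas,
          abs_of_pos ht, smul_eq_mul]
    _ = ENNReal.ofReal t * ∫⁻ u, (Ioo (1 / 2 : ℝ) 1).indicator (fun u ↦ G (t * u)) u := by
        congr 1
        refine lintegral_congr fun u ↦ ?_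
        by_cases hu : u ∈ Ioo (1 / 2 : ℝ) 1
        · have hmem : t * u ∈ Ioo (t / 2) t := ⟨by nlinarith [hu.1], by nlinarith [hu.2]⟩
          rw [indicator_of_mem hmem, indicator_of_mem hu]
        · have hmem : t * u ∉ Ioo (t / 2) t := fun h ↦ hu ⟨by nlinarith [h.1], by nlinarith [h.2]⟩
          rw [indicator_of_notMem hmem, indicator_of_notMem hu]
    _ = ENNReal.ofReal t * ∫⁻ u in Ioo (1 / 2 : ℝ) 1, G (t * u) := by
        rw [lintegral_indicator measurableSet_Ioo]

end OneDimTwo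

/-! ### §3 The estimate for `ℱ_f⁺` about a fixed centre ((2.17)–(2.21)) -/

section Core

variable {d : ℕ} {M : Type*} [TopologicalSpace M] [ChartedSpace (EuclideanSpace ℝ (Fin d)) M]
  [IsManifold 𝓘(ℝ, EuclideanSpace ℝ (Fin d)) ∞ M] [T2Space M]
  (g : PseudoRiemannianMetric 𝓘(ℝ, EuclideanSpace ℝ (Fin d)) ∞ (EuclideanSpace ℝ (Fin d))
    (TangentSpace 𝓘(ℝ, EuclideanSpace ℝ (Fin d)) : M → Type _)) [g.HasLeviCivita]
  [CovariantDerivative.ContMDiffCovariantDerivative g.leviCivita 1]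
  [CovariantDerivative.ContMDiffCovariantDerivative g.leviCivita ∞]

/-- **The half segment inequality about a fixed centre** (Cheeger–Colding 1996, proof of
Thm. 2.11, (2.17)–(2.21)). On a connected Riemannian `d`-manifold (`d ≥ 1`) with geodesically
complete Levi-Civita connection and `Ric ≥ -(d-1) g`, fix `x`, a measurable `f ≥ 0`, a measurable
set `B` with `d(x, y) ≤ D` on `B`, and a measurable `U` containing the second half
`γ_v([1/2, 1])` of every minimal geodesic `γ_v` from `x` to a point of `B`. If `y ↦ ℱ_f⁺(x, y)`
is measurable then
  `∫_B ℱ_f⁺(x, y) dy ≤ (2 cosh(D/2))^{d-1} · D · ∫_U f`.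
Proof: in exponential polar coordinates about `x` (`expPolar_data`: `F = exp_x ∘ L` is injective
on the open star-shaped `W = L⁻¹ ID(x)` with the area formula, and `M ∖ F(W)` is null), for
`z ∈ W` the minimal geodesic to `F z` is `γ_{Lz}`, so `ℱ⁺(x, F z) ≤ ∫_{|z|/2}^{|z|} f(F(s ẑ)) ds`;
along each ray the polar density `𝒜(t) = 𝟙_W 𝒥(tθ) t^{d-1}` satisfies
`𝒜(t) sinh^{d-1}(s) ≤ 𝒜(s) sinh^{d-1}(t)` for `s ≤ t` (Bishop–Gromov along rays,
`indicator_jacobian_mul_sinh_pow_le`), hence `𝒜(t) ≤ (2cosh(D/2))^{d-1} 𝒜(s)` for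
`t/2 ≤ s ≤ t ≤ D`; exchanging the `s`- and `t`-integrals (`setLIntegral_mul_setLIntegral_half_le`)
and returning through polar coordinates and the area formula gives the claim.
[cite: CheegerColding1996, §2, Thm. 2.11 (proof, (2.17)–(2.21))] -/
theorem setLIntegral_segmentIntegral_half_le (hd : 0 < d) [ConnectedSpace M] [T3Space M]
    [MeasurableSpace M] [BorelSpace M] (hg : g.IsRiemannian)
    (hc : IsGeodesicallyComplete g.leviCivita)
    (hRic : ∀ (x : M) (w : TangentSpace 𝓘(ℝ, (EuclideanSpace ℝ (Fin d))) x),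
      -((d : ℝ) - 1) * g.val x w w ≤ g.leviCivita.ricci x w w)
    (x : M) {B U : Set M} (hB : MeasurableSet B) (hU : MeasurableSet U) {D : ℝ} (hD : 0 ≤ D)
    (hBD : ∀ y ∈ B, g.edist hg x y ≤ ENNReal.ofReal D)
    (hBU : ∀ y ∈ B, ∀ v : TangentSpace 𝓘(ℝ, (EuclideanSpace ℝ (Fin d))) x,
      IsMinimizingUpTo g hg x v 1 → expMap g.leviCivita x v = y →
        ∀ t ∈ Icc (1 / 2 : ℝ) 1, expMap g.leviCivita x (t • v) ∈ U)
    {f : M → ℝ≥0∞} (hf : Measurable f)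
    (hℱ : Measurable fun y ↦ segmentIntegral g hg f (1 / 2) 1 x y) :
    ∫⁻ y in B, segmentIntegral g hg f (1 / 2) 1 x y
        ∂(riemannianMeasure (I := 𝓘(ℝ, (EuclideanSpace ℝ (Fin d))))
          (g.toContMDiffRiemannianMetric hg)) ≤
      ENNReal.ofReal ((2 * Real.cosh (D / 2)) ^ (d - 1)) * ENNReal.ofReal D *
        ∫⁻ y in U, f y ∂(riemannianMeasure (I := 𝓘(ℝ, (EuclideanSpace ℝ (Fin d))))
          (g.toContMDiffRiemannianMetric hg)) := by
  classical
  haveI : Nontrivial (EuclideanSpace ℝ (Fin d)) := by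
    have : 0 < Module.finrank ℝ (EuclideanSpace ℝ (Fin d)) := by
      rw [finrank_euclideanSpace_fin]; exact hd
    exact Module.finrank_pos_iff.1 this
  haveI : Fact ((1 : ℕ∞ω) ≤ ((⊤ : ℕ∞) : ℕ∞ω)) := ⟨by exact_mod_cast le_top⟩
  obtain ⟨L, hL⟩ := exists_linearIsometry_tangentSpace g hg x
  obtain ⟨hinj, harea, ⟨N, hNm, hN0, hΦN, hpolar⟩, hseg⟩ := expPolar_data g hd hg hc x L hL
  set h := g.toContMDiffRiemannianMetric hg with hh_def
  set vol : Measure M := riemannianMeasure (I := 𝓘(ℝ, (EuclideanSpace ℝ (Fin d)))) h with hvol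
  set Φ : (EuclideanSpace ℝ (Fin d)) → M := fun z ↦ expMap g.leviCivita x (L z) with hΦ_def
  have hΦs : ContMDiff 𝓘(ℝ, (EuclideanSpace ℝ (Fin d))) 𝓘(ℝ, (EuclideanSpace ℝ (Fin d))) 1 Φ :=
    ((contMDiff_expMap_infty hc x).of_le (by exact_mod_cast le_top)).comp
      L.toContinuousLinearMap.contDiff.contMDiff
  have hΦm : Measurable Φ := hΦs.continuous.measurable
  set Jac : (EuclideanSpace ℝ (Fin d)) → ℝ≥0∞ := fun z ↦ ENNReal.ofReal (Real.sqrt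
    (Matrix.of fun i j : Fin d ↦ g.val (Φ z)
      (mfderiv 𝓘(ℝ, (EuclideanSpace ℝ (Fin d))) 𝓘(ℝ, (EuclideanSpace ℝ (Fin d))) Φ z
        (EuclideanSpace.single i 1))
      (mfderiv 𝓘(ℝ, (EuclideanSpace ℝ (Fin d))) 𝓘(ℝ, (EuclideanSpace ℝ (Fin d))) Φ z
        (EuclideanSpace.single j 1))).det) with hJac_def
  have hJac_meas : Measurable Jac :=
    ENNReal.measurable_ofReal.comp (continuous_sqrt_det_inner_mfderiv h hΦs).measurable
  set W : Set (EuclideanSpace ℝ (Fin d)) := {z | (show TangentSpace 𝓘(ℝ, (EuclideanSpace ℝ (Fin d))) x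
    from L z) ∈ injectivityDomain g hg x} with hW_def
  have hWo : IsOpen W :=
    (isOpen_injectivityDomain_of_isGeodesicallyComplete g le_rfl hg hc x).preimage L.continuous
  have hWm : MeasurableSet W := hWo.measurableSet
  -- abbreviations: `ℱ⁺(x, ·)`, `f` cut off to `U`, the constant
  set ℱ : M → ℝ≥0∞ := fun y ↦ segmentIntegral g hg f (1 / 2) 1 x y with hℱ_def
  set fU : M → ℝ≥0∞ := U.indicator f with hfU_def
  have hfUm : Measurable fU := hf.indicator hU
  set C₁ : ℝ≥0∞ := ENNReal.ofReal ((2 * Real.cosh (D / 2)) ^ (d - 1)) with hC₁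
  have hnorm : ∀ z : EuclideanSpace ℝ (Fin d), Real.sqrt (g.val x (L z) (L z)) = ‖z‖ := fun z ↦ by
    rw [hL, real_inner_self_eq_norm_sq, Real.sqrt_sq (norm_nonneg _)]
  -- Step 1: `B ⊆ Φ(W ∩ Φ⁻¹ B) ∪ Φ(N)`, `Φ(N)` null
  have hcover : B ⊆ Φ '' (W ∩ Φ ⁻¹' B) ∪ Φ '' N := by
    intro y hy
    obtain ⟨z, hzy, -, -, hzWN⟩ := hpolar y
    rcases hzWN with hzW | hzN
    · refine Or.inl ⟨z, ⟨hzW, ?_⟩, hzy⟩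
      show Φ z ∈ B
      rw [show Φ z = y from hzy]; exact hy
    · exact Or.inr ⟨z, hzN, hzy⟩
  have h1 : ∫⁻ y in B, ℱ y ∂vol ≤ ∫⁻ y in Φ '' (W ∩ Φ ⁻¹' B), ℱ y ∂vol := by
    calc ∫⁻ y in B, ℱ y ∂vol ≤ ∫⁻ y in Φ '' (W ∩ Φ ⁻¹' B) ∪ Φ '' N, ℱ y ∂vol :=
          lintegral_mono_set hcover
      _ ≤ (∫⁻ y in Φ '' (W ∩ Φ ⁻¹' B), ℱ y ∂vol) + ∫⁻ y in Φ '' N, ℱ y ∂vol :=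
          lintegral_union_le _ _ _
      _ = ∫⁻ y in Φ '' (W ∩ Φ ⁻¹' B), ℱ y ∂vol := by
          rw [setLIntegral_measure_zero _ _ hΦN, add_zero]
  -- Step 2: the area formula
  have h2 : ∫⁻ y in Φ '' (W ∩ Φ ⁻¹' B), ℱ y ∂vol = ∫⁻ z in W ∩ Φ ⁻¹' B, ℱ (Φ z) * Jac z :=
    setLIntegral_image_eq_setLIntegral_mul_jacobian h hWo hΦs hinj (hWm.inter (hB.preimage hΦm))
      inter_subset_left hℱ
  -- Step 3: the pointwise bound on `W ∩ Φ⁻¹ B` along the ray through `z = t θ`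
  set Ψ : (EuclideanSpace ℝ (Fin d)) → ℝ≥0∞ := (W ∩ Φ ⁻¹' B).indicator fun z ↦ ℱ (Φ z) * Jac z
    with hΨ_def
  have hΨm : Measurable Ψ := ((hℱ.comp hΦm).mul hJac_meas).indicator (hWm.inter (hB.preimage hΦm))
  have h3 : ∫⁻ z in W ∩ Φ ⁻¹' B, ℱ (Φ z) * Jac z = ∫⁻ z, Ψ z := by
    rw [hΨ_def, lintegral_indicator (hWm.inter (hB.preimage hΦm))]
  -- ray functions
  set Jθ : (EuclideanSpace ℝ (Fin d)) → ℝ → ℝ≥0∞ := fun θ t ↦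
    W.indicator Jac (t • θ) * ENNReal.ofReal (t ^ (d - 1)) with hJθ_def
  set Fθ : (EuclideanSpace ℝ (Fin d)) → ℝ → ℝ≥0∞ := fun θ s ↦ fU (Φ (s • θ)) with hFθ_def
  have hJθm : ∀ θ, Measurable (Jθ θ) := fun θ ↦
    ((hJac_meas.indicator hWm).comp (continuous_id.smul continuous_const).measurable).mul
      (ENNReal.measurable_ofReal.comp (continuous_id.pow _).measurable)
  have hFθm : ∀ θ, Measurable (Fθ θ) := fun θ ↦
    hfUm.comp (hΦm.comp (continuous_id.smul continuous_const).measurable)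
  have hpt : ∀ θ : EuclideanSpace ℝ (Fin d), ‖θ‖ = 1 → ∀ t ∈ Ioi (0 : ℝ),
      Ψ (t • θ) * ENNReal.ofReal (t ^ (d - 1)) ≤
        (Ioc 0 D).indicator (fun t ↦ Jθ θ t * ∫⁻ s in Ioo (t / 2) t, Fθ θ s) t := by
    intro θ hθ t ht
    have ht0 : 0 < t := ht
    have hnt : ‖t • θ‖ = t := by rw [norm_smul, hθ, mul_one, Real.norm_of_nonneg ht0.le]
    by_cases hz : t • θ ∈ W ∩ Φ ⁻¹' B
    · obtain ⟨hzW, hzB⟩ := hz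
      have hzB' : Φ (t • θ) ∈ B := hzB
      have hdist : g.edist hg x (Φ (t • θ)) = ENNReal.ofReal t := by
        have h' := (hseg _ hzW).1
        rw [hnt] at h'
        exact h'
      have htD : t ≤ D := by
        have := hBD _ hzB'
        rw [hdist] at this
        exact (ENNReal.ofReal_le_ofReal_iff hD).1 this
      have hmin : IsMinimizingUpTo g hg x
          (show TangentSpace 𝓘(ℝ, (EuclideanSpace ℝ (Fin d))) x from L (t • θ)) 1 := by
        rw [isMinimizingUpTo_one_iff hg hc, hnorm, hnt]
        exact hdist.symm
      -- `ℱ⁺(x, Φ(tθ)) ≤ ∫_{(t/2, t)} fU(Φ(s θ)) ds`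
      have hℱle : ℱ (Φ (t • θ)) ≤ ∫⁻ s in Ioo (t / 2) t, Fθ θ s := by
        have hle := segmentIntegral_le hg f (1 / 2) 1 hmin rfl
        rw [hnorm, hnt] at hle
        refine hle.trans (le_of_eq ?_)
        rw [setLIntegral_Ioo_half_eq (hFθm θ) ht0]
        congr 1
        refine setLIntegral_congr_fun measurableSet_Ioo fun u hu ↦ ?_
        have hmemU : expMap g.leviCivita x (u • (show TangentSpace 𝓘(ℝ, (EuclideanSpace ℝ (Fin d))) x
            from L (t • θ))) ∈ U :=
          hBU _ hzB' _ hmin rfl u ⟨hu.1.le, hu.2.le⟩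
        have hpt' : expMap g.leviCivita x (u • (show TangentSpace 𝓘(ℝ, (EuclideanSpace ℝ (Fin d))) x
            from L (t • θ))) = Φ ((t * u) • θ) := by
          show expMap g.leviCivita x (u • L (t • θ)) = expMap g.leviCivita x (L ((t * u) • θ))
          rw [← map_smul, smul_smul, mul_comm u t]
        show f (expMap g.leviCivita x (u • L (t • θ))) = fU (Φ ((t * u) • θ))
        rw [hfU_def, indicator_of_mem (by rw [← hpt']; exact hmemU), ← hpt']
        rfl
      rw [indicator_of_mem (show t ∈ Ioc 0 D from ⟨ht0, htD⟩), hΨ_def,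
        indicator_of_mem (show t • θ ∈ W ∩ Φ ⁻¹' B from ⟨hzW, hzB⟩), hJθ_def]
      simp only
      rw [indicator_of_mem hzW]
      calc ℱ (Φ (t • θ)) * Jac (t • θ) * ENNReal.ofReal (t ^ (d - 1))
          ≤ (∫⁻ s in Ioo (t / 2) t, Fθ θ s) * Jac (t • θ) * ENNReal.ofReal (t ^ (d - 1)) :=
            mul_le_mul' (mul_le_mul' hℱle le_rfl) le_rfl
        _ = Jac (t • θ) * ENNReal.ofReal (t ^ (d - 1)) * ∫⁻ s in Ioo (t / 2) t, Fθ θ s := by ring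
    · rw [hΨ_def, indicator_of_notMem hz, zero_mul]
      exact zero_le
  -- Step 4: the directional comparison `Jθ t ≤ C₁ Jθ s` for `t/2 < s < t ≤ D`
  have hJcomp : ∀ θ : EuclideanSpace ℝ (Fin d), ‖θ‖ = 1 → ∀ s t : ℝ, 0 < t → t / 2 < s → s < t →
      t ≤ D → Jθ θ t ≤ C₁ * Jθ θ s := by
    intro θ hθ s t ht hts hst htD
    have hs : 0 < s := by linarith
    have hcross := indicator_jacobian_mul_sinh_pow_le g hg hc hRic x L hL θ hθ hs hst.le
    -- `Jθ t · sinh^{d-1} s ≤ Jθ s · sinh^{d-1} t ≤ Jθ s · C₁ · sinh^{d-1} s`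
    have hsinh : ENNReal.ofReal (Real.sinh t ^ (d - 1)) ≤
        C₁ * ENNReal.ofReal (Real.sinh s ^ (d - 1)) := by
      rw [hC₁, ← ENNReal.ofReal_mul (pow_nonneg (by positivity) _)]
      exact ENNReal.ofReal_le_ofReal (sinh_pow_le_mul_sinh_pow ht hts.le htD (d - 1))
    have hpos : ENNReal.ofReal (Real.sinh s ^ (d - 1)) ≠ 0 :=
      (ENNReal.ofReal_pos.2 (pow_pos (Real.sinh_pos_iff.2 hs) _)).ne'
    have key : Jθ θ t * ENNReal.ofReal (Real.sinh s ^ (d - 1)) ≤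
        C₁ * Jθ θ s * ENNReal.ofReal (Real.sinh s ^ (d - 1)) :=
      calc Jθ θ t * ENNReal.ofReal (Real.sinh s ^ (d - 1))
          ≤ Jθ θ s * ENNReal.ofReal (Real.sinh t ^ (d - 1)) := hcross
        _ ≤ Jθ θ s * (C₁ * ENNReal.ofReal (Real.sinh s ^ (d - 1))) := mul_le_mul' le_rfl hsinh
        _ = C₁ * Jθ θ s * ENNReal.ofReal (Real.sinh s ^ (d - 1)) := by ring
    exact (ENNReal.mul_le_mul_iff_left hpos ENNReal.ofReal_ne_top).1 key
  -- Step 5: per ray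
  have hray : ∀ θ : EuclideanSpace ℝ (Fin d), ‖θ‖ = 1 →
      ∫⁻ t in Ioi (0 : ℝ), Ψ (t • θ) * ENNReal.ofReal (t ^ (d - 1)) ≤
        C₁ * ENNReal.ofReal D * ∫⁻ s in Ioi (0 : ℝ), Jθ θ s * Fθ θ s := by
    intro θ hθ
    calc ∫⁻ t in Ioi (0 : ℝ), Ψ (t • θ) * ENNReal.ofReal (t ^ (d - 1))
        ≤ ∫⁻ t in Ioi (0 : ℝ), (Ioc 0 D).indicator
            (fun t ↦ Jθ θ t * ∫⁻ s in Ioo (t / 2) t, Fθ θ s) t :=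
          lintegral_mono_ae (ae_restrict_of_forall_mem measurableSet_Ioi (hpt θ hθ))
      _ = ∫⁻ t in Ioc 0 D, Jθ θ t * ∫⁻ s in Ioo (t / 2) t, Fθ θ s := by
          rw [← lintegral_indicator measurableSet_Ioc, ← lintegral_indicator measurableSet_Ioi]
          refine lintegral_congr fun t ↦ ?_
          by_cases ht : t ∈ Ioc 0 D
          · rw [indicator_of_mem (show t ∈ Ioi (0 : ℝ) from ht.1), indicator_of_mem ht]
          · rw [indicator_of_notMem ht]
            by_cases ht' : t ∈ Ioi (0 : ℝ)
            · rw [indicator_of_mem ht', indicator_of_notMem ht]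
            · rw [indicator_of_notMem ht']
      _ ≤ C₁ * ENNReal.ofReal D * ∫⁻ s in Ioo 0 D, Jθ θ s * Fθ θ s :=
          setLIntegral_mul_setLIntegral_half_le (hJθm θ) (hFθm θ) (hJcomp θ hθ)
      _ ≤ C₁ * ENNReal.ofReal D * ∫⁻ s in Ioi (0 : ℝ), Jθ θ s * Fθ θ s :=
          mul_le_mul' le_rfl (lintegral_mono_set fun s hs ↦ hs.1)
  -- Step 6: back through polar coordinates and the area formula
  set Ψ₂ : (EuclideanSpace ℝ (Fin d)) → ℝ≥0∞ := fun z ↦ W.indicator Jac z * fU (Φ z) with hΨ₂_def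
  have hΨ₂m : Measurable Ψ₂ := (hJac_meas.indicator hWm).mul (hfUm.comp hΦm)
  have hΨ₂ray : ∀ θ : EuclideanSpace ℝ (Fin d), ∀ s : ℝ,
      Ψ₂ (s • θ) * ENNReal.ofReal (s ^ (d - 1)) = Jθ θ s * Fθ θ s := by
    intro θ s
    show W.indicator Jac (s • θ) * fU (Φ (s • θ)) * ENNReal.ofReal (s ^ (d - 1)) =
      W.indicator Jac (s • θ) * ENNReal.ofReal (s ^ (d - 1)) * fU (Φ (s • θ))
    ring
  have h6 : ∫⁻ z, Ψ₂ z = ∫⁻ y in Φ '' W, fU y ∂vol := by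
    rw [setLIntegral_image_eq_setLIntegral_mul_jacobian h hWo hΦs hinj hWm subset_rfl hfUm,
      ← lintegral_indicator hWm]
    refine lintegral_congr fun z ↦ ?_
    rw [hΨ₂_def]
    by_cases hz : z ∈ W
    · simp only [indicator_of_mem hz]
      rw [mul_comm]
      rfl
    · simp only [indicator_of_notMem hz, zero_mul]
  -- assembly
  calc ∫⁻ y in B, ℱ y ∂vol
      ≤ ∫⁻ y in Φ '' (W ∩ Φ ⁻¹' B), ℱ y ∂vol := h1
    _ = ∫⁻ z, Ψ z := by rw [h2, h3]
    _ = ∫⁻ θ : Metric.sphere (0 : (EuclideanSpace ℝ (Fin d))) 1,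
          ∫⁻ t in Ioi (0 : ℝ), Ψ (t • (θ : (EuclideanSpace ℝ (Fin d)))) * ENNReal.ofReal (t ^ (d - 1))
            ∂volume ∂(volume : Measure (EuclideanSpace ℝ (Fin d))).toSphere :=
        lintegral_eq_lintegral_sphere_Ioi hd _ hΨm
    _ ≤ ∫⁻ θ : Metric.sphere (0 : (EuclideanSpace ℝ (Fin d))) 1,
          C₁ * ENNReal.ofReal D * ∫⁻ s in Ioi (0 : ℝ), Jθ θ s * Fθ θ s
            ∂volume ∂(volume : Measure (EuclideanSpace ℝ (Fin d))).toSphere :=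
        lintegral_mono fun θ ↦ hray θ (mem_sphere_zero_iff_norm.1 θ.2)
    _ = C₁ * ENNReal.ofReal D * ∫⁻ θ : Metric.sphere (0 : (EuclideanSpace ℝ (Fin d))) 1,
          ∫⁻ s in Ioi (0 : ℝ), Ψ₂ (s • (θ : (EuclideanSpace ℝ (Fin d)))) * ENNReal.ofReal (s ^ (d - 1))
            ∂volume ∂(volume : Measure (EuclideanSpace ℝ (Fin d))).toSphere := by
        rw [lintegral_const_mul' _ _ (ENNReal.mul_ne_top ENNReal.ofReal_ne_top ENNReal.ofReal_ne_top)]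
        congr 1
        refine lintegral_congr fun θ ↦ setLIntegral_congr_fun measurableSet_Ioi fun s _ ↦ ?_
        rw [hΨ₂ray]
    _ = C₁ * ENNReal.ofReal D * ∫⁻ z, Ψ₂ z := by
        rw [lintegral_eq_lintegral_sphere_Ioi hd _ hΨ₂m]
    _ = C₁ * ENNReal.ofReal D * ∫⁻ y in Φ '' W, fU y ∂vol := by rw [h6]
    _ ≤ C₁ * ENNReal.ofReal D * ∫⁻ y, fU y ∂vol :=
        mul_le_mul' le_rfl (setLIntegral_le_lintegral _ _)
    _ = C₁ * ENNReal.ofReal D * ∫⁻ y in U, f y ∂vol := by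
        rw [hfU_def, lintegral_indicator hU]

end Core

/-! ### §4 Lower semicontinuity and measurability of `ℱ_f` -/

section FirstCountable

/-- A charted space over a first countable model is first countable (neighbourhood filters are
images of those of the model under the inverse charts). [folklore] -/
theorem ChartedSpace.firstCountableTopology (H : Type*) [TopologicalSpace H]
    [FirstCountableTopology H] (M : Type*) [TopologicalSpace M] [ChartedSpace H M] :
    FirstCountableTopology M :=
  ⟨fun q ↦ by
    rw [← (chartAt H q).symm_map_nhds_eq (mem_chart_source H q)]
    infer_instance⟩

end FirstCountable

section Measurability

variable {E : Type*} [NormedAddCommGroup E] [NormedSpace ℝ E] [FiniteDimensional ℝ E]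
  [CompleteSpace E] {M : Type*} [TopologicalSpace M] [ChartedSpace E M] [IsManifold 𝓘(ℝ, E) ∞ M]
  [T2Space M]
  (g : PseudoRiemannianMetric 𝓘(ℝ, E) ∞ E (TangentSpace 𝓘(ℝ, E) : M → Type _)) [g.HasLeviCivita]
  [CovariantDerivative.ContMDiffCovariantDerivative g.leviCivita 1]

omit [FiniteDimensional ℝ E] [CompleteSpace E] [T2Space M] [g.HasLeviCivita]
  [CovariantDerivative.ContMDiffCovariantDerivative g.leviCivita 1] in
/-- The tangent bundle of a manifold modelled on `E` is first countable. [folklore] -/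
theorem firstCountableTopology_tangentBundle : FirstCountableTopology (TangentBundle 𝓘(ℝ, E) M) := by
  haveI : FirstCountableTopology (ModelProd E E) := inferInstanceAs (FirstCountableTopology (E × E))
  exact ChartedSpace.firstCountableTopology (ModelProd E E) (TangentBundle 𝓘(ℝ, E) M)

/-- **`exp` is continuous on `TM`** for a geodesically complete connection
(`contMDiffOn_expMap_totalSpace` on `𝓔 = TM`). [cite: LeeRiemannianManifolds2018, Prop. 5.19] -/
theorem continuous_expMap_totalSpace (hc : IsGeodesicallyComplete g.leviCivita) :
    Continuous fun p : TangentBundle 𝓘(ℝ, E) M ↦ expMap g.leviCivita p.proj p.2 := by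
  have h := contMDiffOn_expMap_totalSpace (cov := g.leviCivita) (k := 1) le_rfl
  have huniv : {p : TangentBundle 𝓘(ℝ, E) M |
      (1 : ℝ) ∈ maximalGeodesicDomain g.leviCivita p.proj p.2} = univ :=
    eq_univ_of_forall fun p ↦ by
      show (1 : ℝ) ∈ maximalGeodesicDomain g.leviCivita p.proj p.2
      rw [(maximalGeodesic_of_isGeodesicallyComplete hc p.proj p.2).1]; exact mem_univ _
  rw [huniv] at h
  exact (contMDiffOn_univ.1 h).continuous

omit [FiniteDimensional ℝ E] [CompleteSpace E] [T2Space M] [g.HasLeviCivita]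
  [CovariantDerivative.ContMDiffCovariantDerivative g.leviCivita 1] in
/-- Fibrewise scaling `(x, v) ↦ (x, t v)` is continuous on `TM`. [folklore] -/
theorem continuous_constSMul_tangentBundle (t : ℝ) :
    Continuous fun p : TangentBundle 𝓘(ℝ, E) M ↦
      (TotalSpace.mk' E p.proj (t • p.2) : TangentBundle 𝓘(ℝ, E) M) := by
  have h : ContMDiff 𝓘(ℝ, E).tangent 𝓘(ℝ, E).tangent 1
      (fun p : TangentBundle 𝓘(ℝ, E) M ↦
        (TotalSpace.mk' E p.proj (t • p.2) : TangentBundle 𝓘(ℝ, E) M)) := fun p ↦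
    contMDiffAt_liftAlong_smul (I := 𝓘(ℝ, E)) (M := M) (J := 𝓘(ℝ, E).tangent)
      (c := fun p : TangentBundle 𝓘(ℝ, E) M ↦ p.proj) (Z := fun p ↦ p.2) (f := fun _ ↦ t)
      (show ContMDiffAt 𝓘(ℝ, E).tangent 𝓘(ℝ, E).tangent 1
        (fun p : TangentBundle 𝓘(ℝ, E) M ↦ (TotalSpace.mk' E p.proj p.2 : TangentBundle 𝓘(ℝ, E) M)) p
        from contMDiffAt_id) contMDiffAt_const
  exact h.continuous

/-- The radial curves `t ↦ exp_x(t v)` of a complete connection are continuous. [folklore] -/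
theorem continuous_expMap_smul_line (hc : IsGeodesicallyComplete g.leviCivita) (x : M)
    (v : TangentSpace 𝓘(ℝ, E) x) : Continuous fun t : ℝ ↦ expMap g.leviCivita x (t • v) := by
  haveI : Fact ((1 : ℕ∞ω) ≤ (∞ : ℕ∞ω)) := ⟨by exact_mod_cast le_top⟩
  have hgeo : IsGeodesic g.leviCivita (fun t : ℝ ↦ expMap g.leviCivita x (t • v)) :=
    isGeodesic_expMap_smul_of_isGeodesicallyComplete hc x v
  exact continuous_iff_continuousAt.2 fun t ↦
    (IsGeodesicOn.mdifferentiableAt_holds (hgeo.isGeodesicOn univ) (mem_univ t)).continuousAt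

/-- **`ℱ_f^{(a,b)}` is lower semicontinuous on `M × M` for lower semicontinuous `f ≥ 0`**
(the regularity implicit in Cheeger–Colding's integral `∫_{A₁×A₂} ℱ_f`). Proof: sublevel sets
are sequentially closed — given `(xᵢ, yᵢ) → (x, y)` with `ℱ(xᵢ, yᵢ) ≤ c`, choose minimal
geodesics `γ_{vᵢ}` with window integral `< c + 1/i`; the `(xᵢ, vᵢ)` lie in a compact subset of
`TM` (`|vᵢ| = d(xᵢ, yᵢ)` bounded, `exists_isCompact_tangent_superset`), a subsequence converges
to `(x, w)`; by continuity of `exp` on `TM` and of `d`, `γ_w` is a minimal geodesic from `x` to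
`y`; by Fatou's lemma and lower semicontinuity of `f`, its window integral is `≤ c`. [folklore] -/
theorem lowerSemicontinuous_segmentIntegral [ConnectedSpace M] [MeasurableSpace M] [BorelSpace M]
    (hg : g.IsRiemannian) (hc : IsGeodesicallyComplete g.leviCivita) {f : M → ℝ≥0∞}
    (hf : LowerSemicontinuous f) (a b : ℝ) :
    LowerSemicontinuous fun z : M × M ↦ segmentIntegral g hg f a b z.1 z.2 := by
  classical
  haveI : LocallyCompactSpace M := Manifold.locallyCompact_of_finiteDimensional 𝓘(ℝ, E)
  haveI : RegularSpace M := inferInstance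
  haveI : FirstCountableTopology M := ChartedSpace.firstCountableTopology E M
  haveI : FirstCountableTopology (TangentBundle 𝓘(ℝ, E) M) := firstCountableTopology_tangentBundle
  have hfm : Measurable f := hf.measurable
  rw [lowerSemicontinuous_iff_isClosed_preimage]
  intro c
  refine IsSeqClosed.isClosed fun u z hu hz ↦ ?_
  obtain ⟨x, y⟩ := z
  show segmentIntegral g hg f a b x y ≤ c
  rcases eq_or_ne c ⊤ with hc' | hc'
  · rw [hc']; exact le_top
  -- near-minimizers `v n` at `u n`
  have hu' : ∀ n : ℕ, segmentIntegral g hg f a b (u n).1 (u n).2 < c + ((n : ℝ≥0∞) + 1)⁻¹ :=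
    fun n ↦ lt_of_le_of_lt (hu n) (ENNReal.lt_add_right hc' (ENNReal.inv_ne_zero.2 (by simp)))
  choose v hvmin hvexp hvval using fun n ↦ exists_lt_of_segmentIntegral_lt hg (hu' n)
  set p : ℕ → TangentBundle 𝓘(ℝ, E) M := fun n ↦ ⟨(u n).1, v n⟩ with hp_def
  have hux : Tendsto (fun n ↦ (u n).1) atTop (𝓝 x) := (continuous_fst.tendsto _).comp hz
  have huy : Tendsto (fun n ↦ (u n).2) atTop (𝓝 y) := (continuous_snd.tendsto _).comp hz
  have hdist : ∀ n, ENNReal.ofReal (Real.sqrt (g.val (u n).1 (v n) (v n))) =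
      g.edist hg (u n).1 (u n).2 := fun n ↦ by
    rw [(isMinimizingUpTo_one_iff hg hc _ _).1 (hvmin n), hvexp n]
  have hnn : ∀ (x' : M) (v' : TangentSpace 𝓘(ℝ, E) x'), 0 ≤ g.val x' v' v' := fun x' v' ↦ by
    by_cases hv : v' = 0
    · subst hv; simp
    · exact (hg x' v' hv).le
  -- a bound for `g(v n, v n) = d((u n).1, (u n).2)²`
  obtain ⟨R, hR⟩ : ∃ R : ℝ, ∀ n, g.val (u n).1 (v n) (v n) ≤ R := by
    have hK : IsCompact (insert (x, y) (range u)) := hz.isCompact_insert_range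
    have hcont : Continuous fun z : M × M ↦ g.edist hg z.1 z.2 := continuous_edist hg
    obtain ⟨z₀, -, hmax⟩ := hK.exists_isMaxOn (insert_nonempty _ _) hcont.continuousOn
    refine ⟨(g.edist hg z₀.1 z₀.2).toReal ^ 2, fun n ↦ ?_⟩
    have hle : g.edist hg (u n).1 (u n).2 ≤ g.edist hg z₀.1 z₀.2 :=
      hmax (mem_insert_of_mem _ (mem_range_self n))
    rw [← hdist n] at hle
    have h1 : Real.sqrt (g.val (u n).1 (v n) (v n)) ≤ (g.edist hg z₀.1 z₀.2).toReal :=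
      (ENNReal.ofReal_le_iff_le_toReal (edist_ne_top hg _ _)).1 hle
    calc g.val (u n).1 (v n) (v n) = Real.sqrt (g.val (u n).1 (v n) (v n)) ^ 2 :=
          (Real.sq_sqrt (hnn _ _)).symm
      _ ≤ (g.edist hg z₀.1 z₀.2).toReal ^ 2 := pow_le_pow_left₀ (Real.sqrt_nonneg _) h1 2
  -- compactness in `TM` and a convergent subsequence
  have hKx : IsCompact (insert x (range fun n ↦ (u n).1)) := hux.isCompact_insert_range
  obtain ⟨𝒦, h𝒦c, h𝒦⟩ := g.exists_isCompact_tangent_superset (fun x' v' hv' ↦ hg x' v' hv') hKx R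
  have hp𝒦 : ∀ n, p n ∈ 𝒦 := fun n ↦ h𝒦 (p n) (mem_insert_of_mem _ (mem_range_self n)) (hR n)
  obtain ⟨q, -, φ, hφ, hconv⟩ := h𝒦c.tendsto_subseq hp𝒦
  have hqx : q.proj = x := by
    have h1 : Tendsto (fun n ↦ (p (φ n)).proj) atTop (𝓝 q.proj) :=
      ((FiberBundle.continuous_proj E (TangentSpace 𝓘(ℝ, E) : M → Type _)).tendsto q).comp hconv
    exact tendsto_nhds_unique h1 (hux.comp hφ.tendsto_atTop)
  set w : TangentSpace 𝓘(ℝ, E) x := (show TangentSpace 𝓘(ℝ, E) x from (q.2 : E)) with hw_def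
  have hqw : q = (⟨x, w⟩ : TangentBundle 𝓘(ℝ, E) M) := TotalSpace.ext hqx HEq.rfl
  rw [hqw] at hconv
  -- (A) `exp_x w = y`
  have hA : expMap g.leviCivita x w = y := by
    have h1 : Tendsto (fun n ↦ expMap g.leviCivita (p (φ n)).proj (p (φ n)).2) atTop
        (𝓝 (expMap g.leviCivita x w)) :=
      ((continuous_expMap_totalSpace g hc).tendsto (⟨x, w⟩ : TangentBundle 𝓘(ℝ, E) M)).comp hconv
    have h2 : Tendsto (fun n ↦ expMap g.leviCivita (p (φ n)).proj (p (φ n)).2) atTop (𝓝 y) := by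
      have he : (fun n ↦ expMap g.leviCivita (p (φ n)).proj (p (φ n)).2) = fun n ↦ (u (φ n)).2 :=
        funext fun n ↦ hvexp (φ n)
      rw [he]; exact huy.comp hφ.tendsto_atTop
    exact tendsto_nhds_unique h1 h2
  -- (B) `|w| = d(x, y)`: `γ_w` is minimizing
  have hG := g.continuous_val_tangentBundle
  have hnormlim : Tendsto (fun n ↦ ENNReal.ofReal (Real.sqrt (g.val (p (φ n)).proj (p (φ n)).2
      (p (φ n)).2))) atTop (𝓝 (ENNReal.ofReal (Real.sqrt (g.val x w w)))) :=
    ((ENNReal.continuous_ofReal.comp (Real.continuous_sqrt.comp hG)).tendsto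
      (⟨x, w⟩ : TangentBundle 𝓘(ℝ, E) M)).comp hconv
  have hB : IsMinimizingUpTo g hg x w 1 := by
    rw [isMinimizingUpTo_one_iff hg hc, hA]
    have h2 : Tendsto (fun n ↦ ENNReal.ofReal (Real.sqrt (g.val (p (φ n)).proj (p (φ n)).2
        (p (φ n)).2))) atTop (𝓝 (g.edist hg x y)) := by
      have he : (fun n ↦ ENNReal.ofReal (Real.sqrt (g.val (p (φ n)).proj (p (φ n)).2
          (p (φ n)).2))) = fun n ↦ g.edist hg (u (φ n)).1 (u (φ n)).2 :=
        funext fun n ↦ hdist (φ n)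
      rw [he]
      exact ((continuous_edist hg).tendsto (x, y)).comp (hz.comp hφ.tendsto_atTop)
    exact tendsto_nhds_unique hnormlim h2
  -- (C) Fatou along the subsequence
  refine (segmentIntegral_le hg f a b hB hA).trans ?_
  set Aseq : ℕ → ℝ≥0∞ := fun n ↦
    ENNReal.ofReal (Real.sqrt (g.val (p (φ n)).proj (p (φ n)).2 (p (φ n)).2)) with hAseq_def
  set hseq : ℕ → ℝ → ℝ≥0∞ := fun n t ↦
    f (expMap g.leviCivita (p (φ n)).proj (t • (p (φ n)).2)) with hhseq_def
  have hval : ∀ n, Aseq n * ∫⁻ t in Ioo a b, hseq n t < c + ((((φ n : ℕ) : ℝ≥0∞)) + 1)⁻¹ :=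
    fun n ↦ hvval (φ n)
  -- `liminf ≤ c`
  have hlim : liminf (fun n ↦ Aseq n * ∫⁻ t in Ioo a b, hseq n t) atTop ≤ c := by
    refine ENNReal.le_of_forall_pos_le_add fun ε hε _ ↦ ?_
    have hinv : Tendsto (fun n : ℕ ↦ ((((φ n : ℕ) : ℝ≥0∞)) + 1)⁻¹) atTop (𝓝 0) := by
      have h1 : Tendsto (fun m : ℕ ↦ ((m : ℝ≥0∞) + 1)⁻¹) atTop (𝓝 0) := by
        have h0 := ENNReal.tendsto_inv_nat_nhds_zero.comp (tendsto_add_atTop_nat 1)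
        refine h0.congr fun m ↦ ?_
        simp only [Function.comp_apply, Nat.cast_add, Nat.cast_one]
      exact h1.comp hφ.tendsto_atTop
    have hε' : (0 : ℝ≥0∞) < ε := by exact_mod_cast hε
    have hev : ∀ᶠ n in atTop, Aseq n * ∫⁻ t in Ioo a b, hseq n t ≤ c + ε := by
      filter_upwards [(tendsto_order.1 hinv).2 ε hε'] with n hn
      exact (hval n).le.trans (add_le_add le_rfl hn.le)
    exact liminf_le_of_frequently_le' (Eventually.frequently hev)
  -- Fatou and lower semicontinuity of `f`
  have hmeas : ∀ n, Measurable (hseq n) := fun n ↦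
    hfm.comp (continuous_expMap_smul_line g hc _ _).measurable
  have hpt : ∀ t, f (expMap g.leviCivita x (t • w)) ≤ liminf (fun n ↦ hseq n t) atTop := by
    intro t
    have hct : Tendsto (fun n ↦ expMap g.leviCivita (p (φ n)).proj (t • (p (φ n)).2)) atTop
        (𝓝 (expMap g.leviCivita x (t • w))) :=
      (((continuous_expMap_totalSpace g hc).comp (continuous_constSMul_tangentBundle (M := M) t)).tendsto
        (⟨x, w⟩ : TangentBundle 𝓘(ℝ, E) M)).comp hconv
    refine le_of_forall_lt fun y' hy' ↦ ?_
    obtain ⟨y'', hy'1, hy'2⟩ := exists_between hy'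
    exact hy'1.trans_le (le_liminf_of_le (h := (hct.eventually (hf _ y'' hy'2)).mono fun n hn ↦ hn.le))
  have hI : ∫⁻ t in Ioo a b, f (expMap g.leviCivita x (t • w)) ≤
      liminf (fun n ↦ ∫⁻ t in Ioo a b, hseq n t) atTop :=
    calc ∫⁻ t in Ioo a b, f (expMap g.leviCivita x (t • w))
        ≤ ∫⁻ t in Ioo a b, liminf (fun n ↦ hseq n t) atTop := lintegral_mono fun t ↦ hpt t
      _ ≤ liminf (fun n ↦ ∫⁻ t in Ioo a b, hseq n t) atTop := lintegral_liminf_le hmeas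
  have hAlim : liminf Aseq atTop = ENNReal.ofReal (Real.sqrt (g.val x w w)) := hnormlim.liminf_eq
  calc ENNReal.ofReal (Real.sqrt (g.val x w w)) * ∫⁻ t in Ioo a b, f (expMap g.leviCivita x (t • w))
      ≤ liminf Aseq atTop * liminf (fun n ↦ ∫⁻ t in Ioo a b, hseq n t) atTop := by
        rw [hAlim]; exact mul_le_mul' le_rfl hI
    _ ≤ liminf (fun n ↦ Aseq n * ∫⁻ t in Ioo a b, hseq n t) atTop :=
        ENNReal.le_liminf_mul (u := Aseq) (v := fun n ↦ ∫⁻ t in Ioo a b, hseq n t)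
    _ ≤ c := hlim

/-- **`ℱ_f^{(a,b)}` is Borel measurable on `M × M`** (for lower semicontinuous `f ≥ 0` on a
second countable connected complete Riemannian manifold). [folklore] -/
theorem measurable_segmentIntegral [ConnectedSpace M] [SecondCountableTopology M]
    [MeasurableSpace M] [BorelSpace M] (hg : g.IsRiemannian)
    (hc : IsGeodesicallyComplete g.leviCivita) {f : M → ℝ≥0∞} (hf : LowerSemicontinuous f)
    (a b : ℝ) : Measurable fun z : M × M ↦ segmentIntegral g hg f a b z.1 z.2 :=
  (lowerSemicontinuous_segmentIntegral g hg hc hf a b).measurable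

end Measurability

/-! ### §5 The segment inequality -/

section Main

variable {d : ℕ} {M : Type*} [TopologicalSpace M] [ChartedSpace (EuclideanSpace ℝ (Fin d)) M]
  [IsManifold 𝓘(ℝ, EuclideanSpace ℝ (Fin d)) ∞ M] [T2Space M]
  (g : PseudoRiemannianMetric 𝓘(ℝ, EuclideanSpace ℝ (Fin d)) ∞ (EuclideanSpace ℝ (Fin d))
    (TangentSpace 𝓘(ℝ, EuclideanSpace ℝ (Fin d)) : M → Type _)) [g.HasLeviCivita]
  [CovariantDerivative.ContMDiffCovariantDerivative g.leviCivita 1]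
  [CovariantDerivative.ContMDiffCovariantDerivative g.leviCivita ∞]

omit [CovariantDerivative.ContMDiffCovariantDerivative g.leviCivita ∞] in
/-- **Splitting `ℱ_f ≤ ℱ_f⁻ + ℱ_f⁺` off the cut locus**: if `y = exp_x v` with `v ∈ ID(x)` (so
that `γ_v` is THE minimal geodesic from `x` to `y` on `[0, 1]`, `false_of_two_minimizers`), then
`ℱ_f(x, y) ≤ ℱ_f^{(0,1/2)}(x, y) + ℱ_f^{(1/2,1)}(x, y)`. [cite: CheegerColding1996, §2, (2.16)] -/
theorem segmentIntegral_le_add_of_mem_injectivityDomain (hg : g.IsRiemannian)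
    (hc : IsGeodesicallyComplete g.leviCivita) (f : M → ℝ≥0∞) {x : M}
    {v : TangentSpace 𝓘(ℝ, (EuclideanSpace ℝ (Fin d))) x} (hv : v ∈ injectivityDomain g hg x) :
    segmentIntegral g hg f 0 1 x (expMap g.leviCivita x v) ≤
      segmentIntegral g hg f 0 (1 / 2) x (expMap g.leviCivita x v) +
        segmentIntegral g hg f (1 / 2) 1 x (expMap g.leviCivita x v) := by
  haveI : Fact ((1 : ℕ∞ω) ≤ (∞ : ℕ∞ω)) := ⟨by exact_mod_cast le_top⟩
  obtain ⟨s, hs1, hvs⟩ := hv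
  have hv1 : IsMinimizingUpTo g hg x v 1 := hvs.mono hc zero_le_one hs1.le
  -- every minimal geodesic from `x` to `exp_x v` on `[0, 1]` is `γ_v`
  have huniq : ∀ w : TangentSpace 𝓘(ℝ, (EuclideanSpace ℝ (Fin d))) x, IsMinimizingUpTo g hg x w 1 →
      expMap g.leviCivita x w = expMap g.leviCivita x v → w = v := by
    intro w hw hwv
    by_contra hne
    exact false_of_two_minimizers g le_rfl hg hc x (Ne.symm hne) hwv.symm hw hs1 hvs
  -- the value along `γ_v`, split at `t = 1/2`
  set F : ℝ → ℝ≥0∞ := fun t ↦ f (expMap g.leviCivita x (t • v)) with hF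
  set ℓ : ℝ≥0∞ := ENNReal.ofReal (Real.sqrt (g.val x v v)) with hℓ
  have hsplit : ∫⁻ t in Ioo (0 : ℝ) 1, F t ≤
      (∫⁻ t in Ioo (0 : ℝ) (1 / 2), F t) + ∫⁻ t in Ioo (1 / 2 : ℝ) 1, F t := by
    have hsub : Ioo (0 : ℝ) 1 ⊆ (Ioo (0 : ℝ) (1 / 2) ∪ Ioo (1 / 2 : ℝ) 1) ∪ {1 / 2} := by
      intro t ht
      rcases lt_trichotomy t (1 / 2) with h | h | h
      · exact Or.inl (Or.inl ⟨ht.1, h⟩)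
      · exact Or.inr h
      · exact Or.inl (Or.inr ⟨h, ht.2⟩)
    calc ∫⁻ t in Ioo (0 : ℝ) 1, F t
        ≤ ∫⁻ t in (Ioo (0 : ℝ) (1 / 2) ∪ Ioo (1 / 2 : ℝ) 1) ∪ {1 / 2}, F t := lintegral_mono_set hsub
      _ ≤ (∫⁻ t in Ioo (0 : ℝ) (1 / 2) ∪ Ioo (1 / 2 : ℝ) 1, F t) + ∫⁻ t in ({1 / 2} : Set ℝ), F t :=
          lintegral_union_le _ _ _
      _ ≤ ((∫⁻ t in Ioo (0 : ℝ) (1 / 2), F t) + ∫⁻ t in Ioo (1 / 2 : ℝ) 1, F t) + 0 := by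
          refine add_le_add (lintegral_union_le _ _ _) (le_of_eq ?_)
          exact setLIntegral_measure_zero _ _ (measure_singleton _)
      _ = _ := add_zero _
  calc segmentIntegral g hg f 0 1 x (expMap g.leviCivita x v)
      ≤ ℓ * ∫⁻ t in Ioo (0 : ℝ) 1, F t := segmentIntegral_le hg f 0 1 hv1 rfl
    _ ≤ ℓ * ((∫⁻ t in Ioo (0 : ℝ) (1 / 2), F t) + ∫⁻ t in Ioo (1 / 2 : ℝ) 1, F t) :=
        mul_le_mul' le_rfl hsplit
    _ = ℓ * (∫⁻ t in Ioo (0 : ℝ) (1 / 2), F t) + ℓ * ∫⁻ t in Ioo (1 / 2 : ℝ) 1, F t := mul_add _ _ _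
    _ ≤ segmentIntegral g hg f 0 (1 / 2) x (expMap g.leviCivita x v) +
          segmentIntegral g hg f (1 / 2) 1 x (expMap g.leviCivita x v) := by
        refine add_le_add (le_segmentIntegral hg fun w hw hwv ↦ ?_)
          (le_segmentIntegral hg fun w hw hwv ↦ ?_)
        · rw [huniq w hw hwv]
        · rw [huniq w hw hwv]
set_option maxHeartbeats 400000 in -- buildfix (bf3-g26): 160k/180k FAIL, 200k PASS at accept time; line-neutral budget line
/-- **The segment inequality** (Cheeger–Colding, Ann. of Math. 144 (1996), Thm. 2.11; for
`Ric ≥ -(d-1)`, the normalisation of the Cheeger–Colding theory; restated e.g. in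
arXiv:1409.4471, Prop. 1, and arXiv:2111.05202, Thm. 2.2). Let `(M, g)` be a connected second
countable Riemannian `d`-manifold (`d ≥ 1`) with geodesically complete Levi-Civita connection
and `Ric ≥ -(d-1) g`, with Riemannian measure `Vol`. Let `A, B ⊆ M` be measurable with
`d(x, y) ≤ D` for `x ∈ A`, `y ∈ B`, and let `U` be a measurable set containing every minimal
geodesic from a point of `A` to a point of `B`. Then for every lower semicontinuous
`f : M → [0, ∞]`,
  `∫_{A × B} ℱ_f(x, y) d(Vol × Vol) ≤ c(d, D) (Vol A + Vol B) ∫_U f`,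
`c(d, D) = D (2 cosh(D/2))^{d-1}`, where `ℱ_f(x, y) = inf_γ ∫₀^{d(x,y)} f(γ(s)) ds` over the
minimal geodesics `γ` from `x` to `y` (`segmentIntegral`; printed: "`∫_{A₁×A₂} ℱ_f ≤
c(n, D)(Vol(A₁) + Vol(A₂)) ∫_W f`", `c(n, D) = 2D sup_{0 < s/2 ≤ u ≤ s ≤ D} 𝒜(s)/𝒜(u)` for the
model `Ric ≡ -(n-1)`; here the explicit majorant `(2cosh(D/2))^{d-1} ≥ sinh^{d-1}s/sinh^{d-1}u`).
Proof as printed: `ℱ_f = ℱ_f⁻ + ℱ_f⁺` off the (null) cut loci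
(`segmentIntegral_le_add_of_mem_injectivityDomain`), `ℱ_f⁻(x, y) ≤ ℱ_f⁺(y, x)` by reversing
geodesics (`segmentIntegral_le_segmentIntegral_swap`), Tonelli, and the estimate of `ℱ_f⁺` about
each centre in polar coordinates with Bishop–Gromov along rays
(`setLIntegral_segmentIntegral_half_le`). General lower Ricci bounds `(d-1)Λ` follow by scaling.
-- TODO(general form): `Ric ≥ (d-1)Λ g`, and the metric-measure form under (A.2.2).
[cite: CheegerColding1996, §2, Thm. 2.11 ((2.11)–(2.21), pp. 198–200)] -/
theorem setLIntegral_prod_segmentIntegral_le (hd : 0 < d) [ConnectedSpace M] [T3Space M]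
    [SecondCountableTopology M] [MeasurableSpace M] [BorelSpace M] (hg : g.IsRiemannian)
    (hc : IsGeodesicallyComplete g.leviCivita)
    (hRic : ∀ (x : M) (w : TangentSpace 𝓘(ℝ, (EuclideanSpace ℝ (Fin d))) x),
      -((d : ℝ) - 1) * g.val x w w ≤ g.leviCivita.ricci x w w)
    {A B U : Set M} (hA : MeasurableSet A) (hB : MeasurableSet B) (hU : MeasurableSet U)
    {D : ℝ} (hD : 0 ≤ D) (hABD : ∀ x ∈ A, ∀ y ∈ B, g.edist hg x y ≤ ENNReal.ofReal D)
    (hABU : ∀ x ∈ A, ∀ y ∈ B, ∀ v : TangentSpace 𝓘(ℝ, (EuclideanSpace ℝ (Fin d))) x,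
      IsMinimizingUpTo g hg x v 1 → expMap g.leviCivita x v = y →
        ∀ t ∈ Icc (0 : ℝ) 1, expMap g.leviCivita x (t • v) ∈ U)
    {f : M → ℝ≥0∞} (hf : LowerSemicontinuous f) :
    ∫⁻ z in A ×ˢ B, segmentIntegral g hg f 0 1 z.1 z.2
        ∂((riemannianMeasure (I := 𝓘(ℝ, (EuclideanSpace ℝ (Fin d))))
            (g.toContMDiffRiemannianMetric hg)).prod
          (riemannianMeasure (I := 𝓘(ℝ, (EuclideanSpace ℝ (Fin d))))
            (g.toContMDiffRiemannianMetric hg))) ≤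
      ENNReal.ofReal ((2 * Real.cosh (D / 2)) ^ (d - 1)) * ENNReal.ofReal D *
        ((riemannianMeasure (I := 𝓘(ℝ, (EuclideanSpace ℝ (Fin d))))
            (g.toContMDiffRiemannianMetric hg)) A +
          (riemannianMeasure (I := 𝓘(ℝ, (EuclideanSpace ℝ (Fin d))))
            (g.toContMDiffRiemannianMetric hg)) B) *
        ∫⁻ y in U, f y ∂(riemannianMeasure (I := 𝓘(ℝ, (EuclideanSpace ℝ (Fin d))))
          (g.toContMDiffRiemannianMetric hg)) := by
  classical
  haveI : Nontrivial (EuclideanSpace ℝ (Fin d)) := by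
    have : 0 < Module.finrank ℝ (EuclideanSpace ℝ (Fin d)) := by
      rw [finrank_euclideanSpace_fin]; exact hd
    exact Module.finrank_pos_iff.1 this
  haveI : Fact ((1 : ℕ∞ω) ≤ ((⊤ : ℕ∞) : ℕ∞ω)) := ⟨by exact_mod_cast le_top⟩
  haveI : LocallyCompactSpace M :=
    Manifold.locallyCompact_of_finiteDimensional 𝓘(ℝ, (EuclideanSpace ℝ (Fin d)))
  haveI : SigmaCompactSpace M := inferInstance
  set h := g.toContMDiffRiemannianMetric hg with hh_def
  set μ : Measure M := riemannianMeasure (I := 𝓘(ℝ, (EuclideanSpace ℝ (Fin d)))) h with hμ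
  haveI : IsFiniteMeasureOnCompacts μ :=
    ⟨fun K hK ↦ riemannianVolume_lt_top_of_isCompact_holds h le_rfl hK⟩
  haveI : SigmaFinite μ := inferInstance
  have hfm : Measurable f := hf.measurable
  -- the three functionals and their measurability
  set ℱ : M × M → ℝ≥0∞ := fun z ↦ segmentIntegral g hg f 0 1 z.1 z.2 with hℱ_def
  set ℱm : M × M → ℝ≥0∞ := fun z ↦ segmentIntegral g hg f 0 (1 / 2) z.1 z.2 with hℱm_def
  set ℱp : M × M → ℝ≥0∞ := fun z ↦ segmentIntegral g hg f (1 / 2) 1 z.1 z.2 with hℱp_def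
  have hℱ : Measurable ℱ := measurable_segmentIntegral g hg hc hf 0 1
  have hℱm : Measurable ℱm := measurable_segmentIntegral g hg hc hf 0 (1 / 2)
  have hℱp : Measurable ℱp := measurable_segmentIntegral g hg hc hf (1 / 2) 1
  set C : ℝ≥0∞ := ENNReal.ofReal ((2 * Real.cosh (D / 2)) ^ (d - 1)) * ENNReal.ofReal D with hC
  -- Step 1: `ℱ ≤ ℱm + ℱp` almost everywhere (off the cut loci)
  have hsec : ∀ x : M, μ {y | ℱm (x, y) + ℱp (x, y) < ℱ (x, y)} = 0 := by
    intro x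
    obtain ⟨L, hL⟩ := exists_linearIsometry_tangentSpace g hg x
    obtain ⟨-, -, ⟨N, -, -, hΦN, hpolar⟩, -⟩ := expPolar_data g hd hg hc x L hL
    refine measure_mono_null (fun y hy ↦ ?_) hΦN
    obtain ⟨z, hzy, -, -, hzWN⟩ := hpolar y
    rcases hzWN with hzW | hzN
    · exfalso
      have hle := segmentIntegral_le_add_of_mem_injectivityDomain g hg hc f hzW
      rw [hzy] at hle
      exact absurd hy (not_lt.2 hle)
    · exact ⟨z, hzN, hzy⟩
  have hS : MeasurableSet {z : M × M | ℱm z + ℱp z < ℱ z} :=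
    measurableSet_lt (hℱm.add hℱp) hℱ
  have hbad : (μ.prod μ) {z : M × M | ℱm z + ℱp z < ℱ z} = 0 := by
    rw [Measure.measure_prod_null hS]
    exact Eventually.of_forall fun x ↦ hsec x
  have hae : ∀ᵐ z ∂(μ.prod μ).restrict (A ×ˢ B), ℱ z ≤ ℱm z + ℱp z := by
    refine ae_restrict_of_ae ?_
    rw [ae_iff]
    refine measure_mono_null (fun z hz ↦ ?_) hbad
    exact not_le.1 hz
  -- Step 2: the `ℱ⁺` integral by Tonelli and §3, for a pair of sets
  have hcore : ∀ {A' B' : Set M}, MeasurableSet A' → MeasurableSet B' →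
      (∀ x ∈ A', ∀ y ∈ B', g.edist hg x y ≤ ENNReal.ofReal D) →
      (∀ x ∈ A', ∀ y ∈ B', ∀ v : TangentSpace 𝓘(ℝ, (EuclideanSpace ℝ (Fin d))) x,
        IsMinimizingUpTo g hg x v 1 → expMap g.leviCivita x v = y →
          ∀ t ∈ Icc (1 / 2 : ℝ) 1, expMap g.leviCivita x (t • v) ∈ U) →
      ∫⁻ z in A' ×ˢ B', ℱp z ∂(μ.prod μ) ≤ C * μ A' * ∫⁻ y in U, f y ∂μ := by
    intro A' B' hA' hB' hD' hU'
    rw [← Measure.prod_restrict A' B', lintegral_prod _ hℱp.aemeasurable]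
    calc ∫⁻ x in A', ∫⁻ y in B', ℱp (x, y) ∂μ ∂μ
        ≤ ∫⁻ x in A', C * ∫⁻ y in U, f y ∂μ ∂μ := by
          refine lintegral_mono_ae (ae_restrict_of_forall_mem hA' fun x hx ↦ ?_)
          exact setLIntegral_segmentIntegral_half_le g hd hg hc hRic x hB' hU hD (hD' x hx)
            (hU' x hx) hfm (hℱp.comp measurable_prodMk_left)
      _ = C * (∫⁻ y in U, f y ∂μ) * μ A' := by rw [setLIntegral_const, mul_assoc]
      _ = C * μ A' * ∫⁻ y in U, f y ∂μ := by ring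
  -- Step 3: the `ℱ⁺` term
  have hplus : ∫⁻ z in A ×ˢ B, ℱp z ∂(μ.prod μ) ≤ C * μ A * ∫⁻ y in U, f y ∂μ :=
    hcore hA hB hABD fun x hx y hy v hv hvy t ht ↦ hABU x hx y hy v hv hvy t
      ⟨le_trans (by norm_num) ht.1, ht.2⟩
  -- Step 4: the `ℱ⁻` term by symmetry
  have hminus : ∫⁻ z in A ×ˢ B, ℱm z ∂(μ.prod μ) ≤ C * μ B * ∫⁻ y in U, f y ∂μ := by
    have hsym : ∀ z : M × M, ℱm z ≤ ℱp z.swap := fun z ↦ by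
      have h' := segmentIntegral_le_segmentIntegral_swap hg hc f 0 (1 / 2) z.1 z.2
      norm_num at h'
      exact h'
    calc ∫⁻ z in A ×ˢ B, ℱm z ∂(μ.prod μ)
        ≤ ∫⁻ z in A ×ˢ B, ℱp z.swap ∂(μ.prod μ) := lintegral_mono fun z ↦ hsym z
      _ = ∫⁻ z in B ×ˢ A, ℱp z ∂(μ.prod μ) := by
          rw [← Measure.prod_restrict A B, ← Measure.prod_restrict B A,
            lintegral_prod_swap ℱp]
      _ ≤ C * μ B * ∫⁻ y in U, f y ∂μ := by
          refine hcore hB hA (fun y hy x hx ↦ ?_) fun y hy x hx w hw hwx t ht ↦ ?_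
          · rw [g.edist_comm hg]; exact hABD x hx y hy
          · obtain ⟨v, hv, hvy, -, hexp⟩ := exists_reverse_minimizing hg hc hw hwx
            have h1 := hexp (1 - t)
            rw [sub_sub_cancel] at h1
            rw [← h1]
            exact hABU x hx y hy v hv hvy (1 - t) ⟨by linarith [ht.2], by linarith [ht.1]⟩
  -- assembly
  calc ∫⁻ z in A ×ˢ B, ℱ z ∂(μ.prod μ)
      ≤ ∫⁻ z in A ×ˢ B, (ℱm z + ℱp z) ∂(μ.prod μ) := lintegral_mono_ae hae
    _ = (∫⁻ z in A ×ˢ B, ℱm z ∂(μ.prod μ)) + ∫⁻ z in A ×ˢ B, ℱp z ∂(μ.prod μ) :=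
        lintegral_add_left hℱm _
    _ ≤ C * μ B * (∫⁻ y in U, f y ∂μ) + C * μ A * ∫⁻ y in U, f y ∂μ := add_le_add hminus hplus
    _ = C * (μ A + μ B) * ∫⁻ y in U, f y ∂μ := by ring

end Main
end Literature.Geometry.Riemannian
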